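import Summits.HubbardSuperconductivity.HubbardSuperconductivity.Theorems.FunctionFieldCertificateHubbardSymbolCertificateEval

/-!
# Route `FunctionFieldCertificate` — support item `SymbolEvaluation` (stmt-HubbardSuperconductivity-7807)

EVALUATION / SOUNDNESS OF THE FINITE PRESENTATION (card `function-field-kkt-certificates`, D1 + P1):
`Nonempty (SymbolCertificate U δ deg p a) → CertifiedSectorLRO` with the SAME `U`, `δ`, `a` and
some `C`, `L₀`.

The definition request D1 landed as `Literature.MathematicalPhysics.QuantumLattice.SymbolCertificate`
(`TorusSymbolCertificate (hubbardMomentumModel U δ) deg p a`): `L`-independent finite lists of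
symbol-class SOS / KKT / R-channel families with rational weights, two semantic families (`T_L`
sector-null, `-C/L ≤ E_L ≤ C/L`) and the evaluated operator identity on every even torus of side
`L ≥ L₀`. Its evaluation at one side is the tree's `TorusSymbolCertificate.exists_threshold` /
`exists_matrix_identity` (`Literature/…/SymbolCertificateEval.lean`: flatten the weighted SOS and
KKT channels into `Fin n`-indexed families by absorbing `√s_j(κ)`, `√a_m(κ)`, keep `R_L`, `T_L`,
absorb the remainder into the slack, `E_L + (C/L)·1 = Bᴴ B`).

* `symbolEvaluation_at` — the item's content at the certificate's OWN `(U, δ, a)`: the body of the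
  route target `CertifiedSectorLRO` (stmt-7330) at `((U : ℝ), (δ : ℝ), (a : ℝ))` with `∃ C L₀`,
  written on the literal route terms (`hubbardTorus 2 L 1 U`, `L⁻⁴ Δ_d† Δ_d`,
  `szSector (2⌊(1-δ)L²/2⌋) 0`, `Fock (Orb (FermionTorus 2 L))`); it is `exists_threshold` read
  through the `abbrev` `hubbardMomentumModel`.
* The implication forms — `SymbolCertificate U δ deg p a → CertifiedSectorLRO` for `0 < U`,
  `δ ∈ (0, 1/2)`, `0 < a`, and `… → HubbardSuperconductivity` via `certificateSoundness_proof` — are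
  the tree's `certifiedSectorLRO_of_symbolCertificate` / `hubbardSuperconductivity_of_symbolCertificate`
  (`Theorems/FunctionFieldCertificateHubbardSymbolCertificateEval.lean`), not repeated here.

The item is informal on the ledger (no route decl `SymbolEvaluation` yet): typed as the statement of
`symbolEvaluation_at` (quantified over `U δ a deg p c`) it closes by `exact`; typed as the
implication it closes by `certifiedSectorLRO_of_symbolCertificate`. No new definitions. [folklore]
-/

-- the mandated namespace `Summit.<Summit>.<Problem>.Theorems` repeats `HubbardSuperconductivity`
-- (single-problem summit, D-0017), which the `dupNamespace` linter flags on every declaration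
set_option linter.dupNamespace false

namespace Summit.HubbardSuperconductivity.HubbardSuperconductivity.Theorems

open Matrix Literature.MathematicalPhysics.QuantumLattice

/-- **SymbolEvaluation at the certificate's own `(U, δ, a)`** (support item stmt-7807; the body of
the route target `CertifiedSectorLRO` at fixed parameters). A function-field certificate
`c : SymbolCertificate U δ deg p a` yields `C` and `L₀` such that for every even `L ≥ L₀` there
are finitely many matrices `O_i`, `szSector N_L 0`-preserving `Q_i`, a matrix `R` and a sector-null
`T` on `Fock (Orb (FermionTorus 2 L))` with
`L⁻⁴ Δ_d† Δ_d - (a - C/L)·1 = Σ_i O_iᴴ O_i + Σ_i Q_iᴴ (H_L Q_i - Q_i H_L) + (H_L R - R H_L) + T`,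
`H_L = hubbardTorus 2 L 1 U`, `Δ_d = pairField dWaveFormFactor L`, `N_L = 2⌊(1-δ)L²/2⌋`.
Proof: `TorusSymbolCertificate.exists_threshold` for the model `hubbardMomentumModel U δ`
(`C = c.C`, `L₀ = c.L₀`). [folklore] -/
theorem symbolEvaluation_at {U δ : ℚ} {deg p : ℕ} {a : ℚ} (c : SymbolCertificate U δ deg p a) :
    ∃ (C : ℝ) (L₀ : ℕ), ∀ (L : ℕ) [NeZero L], L₀ ≤ L → Even L →
      ∃ (n m : ℕ)
        (O : Fin n → Matrix (Finset (Orb (FermionTorus 2 L))) (Finset (Orb (FermionTorus 2 L))) ℂ)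
        (Q : Fin m → Matrix (Finset (Orb (FermionTorus 2 L))) (Finset (Orb (FermionTorus 2 L))) ℂ)
        (R T : Matrix (Finset (Orb (FermionTorus 2 L))) (Finset (Orb (FermionTorus 2 L))) ℂ),
        (∀ (i : Fin m) (ψ : Fock (Orb (FermionTorus 2 L))),
          ψ ∈ szSector (2 * ⌊(1 - ((δ : ℚ) : ℝ)) * (L : ℝ) ^ 2 / 2⌋₊) 0 →
            Q i *ᵥ ψ ∈ szSector (2 * ⌊(1 - ((δ : ℚ) : ℝ)) * (L : ℝ) ^ 2 / 2⌋₊) 0) ∧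
        (∀ ψ : Fock (Orb (FermionTorus 2 L)),
          ψ ∈ szSector (2 * ⌊(1 - ((δ : ℚ) : ℝ)) * (L : ℝ) ^ 2 / 2⌋₊) 0 →
            star ψ ⬝ᵥ T *ᵥ ψ = 0) ∧
        (1 / (L : ℂ) ^ 4) • ((pairField dWaveFormFactor L)ᴴ * pairField dWaveFormFactor L) -
            ((((a : ℚ) : ℝ) - C / (L : ℝ) : ℝ) : ℂ) •
              (1 : Matrix (Finset (Orb (FermionTorus 2 L))) (Finset (Orb (FermionTorus 2 L))) ℂ) =
          ∑ i, (O i)ᴴ * O i +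
            ∑ i, (Q i)ᴴ * (hubbardTorus 2 L 1 (U : ℝ) * Q i - Q i * hubbardTorus 2 L 1 (U : ℝ)) +
            (hubbardTorus 2 L 1 (U : ℝ) * R - R * hubbardTorus 2 L 1 (U : ℝ)) + T :=
  c.exists_threshold

/-- **SymbolEvaluation, implication form with `Nonempty`** (the informal item verbatim:
`Nonempty (SymbolCertificate U δ deg p a) → CertifiedSectorLRO` with the same `U, δ, a`): for
`0 < U`, `δ ∈ (0, 1/2)`, `0 < a`, an inhabited `SymbolCertificate U δ deg p a` gives the route
target, by the tree's `certifiedSectorLRO_of_symbolCertificate`. [folklore] -/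
theorem certifiedSectorLRO_of_nonempty_symbolCertificate {U δ a : ℚ} {deg p : ℕ} (hU : 0 < U)
    (hδ : ((δ : ℚ) : ℝ) ∈ Set.Ioo (0 : ℝ) (1 / 2)) (ha : 0 < a)
    (h : Nonempty (SymbolCertificate U δ deg p a)) :
    Summit.HubbardSuperconductivity.HubbardSuperconductivity.Theses.FunctionFieldCertificate.CertifiedSectorLRO :=
  h.elim fun c => certifiedSectorLRO_of_symbolCertificate hU hδ ha c

end Summit.HubbardSuperconductivity.HubbardSuperconductivity.Theorems
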